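import Literature.NumberTheory.LFunctions.DobnerSelbergClass
import Mathlib.Analysis.SpecialFunctions.Gamma.Deriv
import Mathlib.Analysis.SpecialFunctions.Complex.LogDeriv
import HarnessLib

/-!
# Dobner's steepest-descent objects for `F ∈ 𝒮♯`: `J_t`, `γ_t`, `A`, `B_{t,n}(s)` (definitions)

RH-FREE literature DEFINITIONS (no named facts, no instances, no notation). Trunk T-ANT
(`Literature/NumberTheory/LFunctions`); §1 of the plan of record for the discharge of
`Literature.NumberTheory.LFunctions.dobner_theorem2` (HOME/drafts/rt/t7-N1-PLAN.md; rt-lead ruling (15),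
rt/STATUS 2026-08-26), companion of `DobnerSelbergClass.lean` (the class `𝒮♯`, the datum
`Literature.NumberTheory.LFunctions.ExtendedSelbergDatum`, `γ = D.gamma`, `ξ^F_t = D.xiDeformed`) and of
the `ζ`-case files `DobnerNewman.lean` / `DobnerSteepestDescent.lean` / `DobnerLemma4Tools.lean`
(`Literature.NumberTheory.LFunctions.dobnerJ`, `dobnerGammaT`, `dobnerB`, `dobnerA`, … for `F = ζ`:
`k = 1`, `ω₁ = ½`, `μ₁ = 0`, `Q = π^{−1/2}`, `m = 1`).

> A. Dobner, *A proof of Newman's conjecture for the extended Selberg class*, Acta Arith. 201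
> (2021) = arXiv:2005.05142 (held; page numbers of the 18-page arXiv text). **Thm. 4** (p. 8):
> `F_t(s) := ∑ exp(−(|t|/4) log² n) aₙ n^{−s}`, `J_t(s) := s + (|t|/2) log Q + (|t|/2) ∑ᵢ ωᵢ Log(ωᵢ s)`,
> `γ_t(s) := γ(s) exp((1/|t|)(s − J_t(s))²)`. **§4** (p. 10): `ξ^F_t(J_t(s)) = ∑ aₙ B_{t,n}(s)`,
> `B_{t,n}(s) := (1/(i√(π|t|))) ∫_{2−i∞}^{2+i∞} γ(z) e^{(J_t(s)−z)²/|t|} n^{−z} dz` (eq. (4.1)),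
> `A := 1/|t| + ∑ᵢ ωᵢ/(2s)`; Lemma 4 (p. 10), Lemma 6 (`𝓘(z) := γ(z) e^{(J_t(s)−z)²/|t|} n^{−z}`,
> p. 11); the contour through `s + (1/2A) log n` and "the contour shift does not pass over any poles
> of the integrand (which come from the Γ factors) because the imaginary parts of these poles are
> uniformly bounded above" (p. 11); eq. (4.3) `A = (1/|t|)(1 + O(|t|/y)) ≍ 1/|t|`.

## Contents (all definitions with bodies; API lemmas proved)

* `ExtendedSelbergDatum.omegaSum = ∑ ωᵢ`, `ExtendedSelbergDatum.poleHeight = ∑ |Im μᵢ|/ωᵢ` (plumbing: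
  a height above every pole/zero of `γ` and above the slit of every `Log(ωᵢ s + μᵢ)`), with
  `differentiableAt_gamma`, `gamma_ne_zero` above that height;
* `ExtendedSelbergDatum.dobnerJ`, `dobnerGammaT`, `dobnerA`, `dobnerShift`, `dobnerCenter`,
  `dobnerI` (the integrand `𝓘`), `dobnerB` (eq. (4.1) on the line `Re z = 2`), `dobnerMainTerm`;
* API: `dobnerB_zero`, `dobnerMainTerm_eq` (main term `= γ_t(s) · LSeries.term (zetaDeformedCoeff t) s n`),
  `norm_dobnerI`, `norm_dobnerGammaT`, `dobnerJ_re`, `dobnerJ_im`, `differentiableAt_dobnerJ`,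
  `differentiableAt_dobnerGammaT`, `dobnerGammaT_ne_zero`, `differentiableAt_dobnerI` /
  `differentiableOn_dobnerI` (risk R1 of the plan in ONE place: all singularities of `𝓘` lie at
  heights `≤ poleHeight`), `norm_dobnerA_sub_le` (eq. (4.3): `‖A − 1/|t|‖ ≤ ∑ωᵢ/Im s` for
  `Im s ≥ 2·poleHeight`), `dobnerA_re_ge`, `norm_dobnerA_ge`, `dobnerA_ne_zero`, `norm_dobnerShift_le`.

## DEVIATION FROM PRINT (proof-internal; admitted by rt-lead ruling (15)(c))

The source defines `J_t(s) := s + (|t|/2) log Q + (|t|/2) ∑ᵢ ωᵢ Log(ωᵢ s)` (Thm. 4, p. 8) and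
`A := 1/|t| + ∑ᵢ ωᵢ/(2s)` (p. 10). This file uses the EXACT-CANCELLATION variants
`J_t(s) := s + (|t|/2)(log Q + ∑ᵢ ωᵢ Log(ωᵢ s + μᵢ))` and `A := 1/|t| + ∑ᵢ ωᵢ²/(2(ωᵢ s + μᵢ))`, i.e.
the first- and second-order Taylor coefficients of `log ∏ᵢ Γ(ωᵢ z + μᵢ)` at `z = s` exactly (via
`Log(w₀)·d + d²/(2w₀)` of `Literature.Analysis.SpecialFunctions.GammaRatioStirling.Gamma_eq_mul_exp_taylor`
at `w₀ = ωᵢ s + μᵢ`, `d = ωᵢ(z − s)`), so that on the saddle-point segment the linear terms cancel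
EXACTLY against the Gaussian factor `e^{(J_t(s) − z)²/|t|}` (the printed choice cancels them up to
`δ(s) = (|t|/2) ∑ᵢ ωᵢ (Log(ωᵢ s + μᵢ) − Log(ωᵢ s)) = O(1/|s|)`, absorbed in the error term of the
printed Lemma 5). The two variants coincide for `μ = 0` (in particular for `F = ζ`, where they are
the tree's `dobnerJ` / `dobnerA`). T2's statement (`Literature.NumberTheory.LFunctions.dobner_theorem2`)
does not mention `J_t`, `A` or `B_{t,n}`: these are objects internal to the proof of Thm. 4 / §3.1,
and §3.1 only uses that `s ↦ J_t(s)` is holomorphic with `Re J_t(s) → +∞` as `Im s → ∞` in a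
vertical strip (true for both variants when `k ≥ 1`). Typing Thm. 4 with the printed `J_t` instead
would cost ≈ +150 lines in the saddle-segment file (carrying `δ(s)` as an extra linear term); if a
later consumer needs it, it is a corollary then. No printed STATEMENT is typed in deviated form.

bears_on: N-C/N-P (COLUMN 3 DBN). WHAT THIS IS NOT: nothing here bears on the truth of RH.
-/

noncomputable section

open Complex Filter Set MeasureTheory

namespace Literature.NumberTheory.LFunctions

namespace ExtendedSelbergDatum

variable (D : ExtendedSelbergDatum)

/-! ### Plumbing: the sum of the `ωᵢ` and a height above all poles of `γ` -/

/-- `W = ∑ᵢ ωᵢ` (the source's `∑_{i=1}^k ωᵢ`, e.g. in `A = 1/|t| + ∑ωᵢ/(2s)`, p. 10). [cite: Dobner2021, §4 p. 10] -/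
def omegaSum : ℝ := ∑ i, D.omega i

/-- A height above which `γ` has neither poles nor zeros and every `ωᵢ s + μᵢ` lies in the open
upper half-plane: `P = ∑ᵢ |Im μᵢ|/ωᵢ` (the poles of `Γ(ωᵢ z + μᵢ)` lie at heights `−Im μᵢ/ωᵢ`;
"the imaginary parts of these poles are uniformly bounded above", p. 11). [cite: Dobner2021, §4 p. 11] -/
def poleHeight : ℝ := ∑ i, |(D.mu i).im| / D.omega i

/-- `∑ ωᵢ ≥ 0`. [cite: Dobner2021, §4 p. 10] -/
theorem omegaSum_nonneg : 0 ≤ D.omegaSum :=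
  Finset.sum_nonneg fun i _ ↦ (D.omega_pos i).le

/-- `∑ ωᵢ > 0` when there is at least one `Γ`-factor. [cite: Dobner2021, §4 p. 10] -/
theorem omegaSum_pos (hk : 0 < D.numGamma) : 0 < D.omegaSum := by
  haveI : Nonempty (Fin D.numGamma) := ⟨⟨0, hk⟩⟩
  exact Finset.sum_pos (fun i _ ↦ D.omega_pos i) Finset.univ_nonempty

/-- `ωᵢ ≤ ∑ ωⱼ`. [cite: Dobner2021, §4 p. 10] -/
theorem omega_le_omegaSum (i : Fin D.numGamma) : D.omega i ≤ D.omegaSum :=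
  Finset.single_le_sum (f := fun j ↦ D.omega j) (fun j _ ↦ (D.omega_pos j).le) (Finset.mem_univ i)

/-- `P ≥ 0`. [cite: Dobner2021, §4 p. 11] -/
theorem poleHeight_nonneg : 0 ≤ D.poleHeight :=
  Finset.sum_nonneg fun i _ ↦ div_nonneg (abs_nonneg _) (D.omega_pos i).le

/-- `|Im μᵢ|/ωᵢ ≤ P`. [cite: Dobner2021, §4 p. 11] -/
theorem abs_im_mu_div_le_poleHeight (i : Fin D.numGamma) : |(D.mu i).im| / D.omega i ≤ D.poleHeight :=
  Finset.single_le_sum (f := fun j ↦ |(D.mu j).im| / D.omega j)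
    (fun j _ ↦ div_nonneg (abs_nonneg _) (D.omega_pos j).le) (Finset.mem_univ i)

/-- Above the pole height, `Im(ωᵢ z + μᵢ) > 0`; quantitatively `Im(ωᵢ z + μᵢ) ≥ ωᵢ (Im z − P)`.
[cite: Dobner2021, §4 p. 11] -/
theorem omega_mul_im_sub_le (i : Fin D.numGamma) (z : ℂ) :
    D.omega i * (z.im - D.poleHeight) ≤ ((D.omega i : ℂ) * z + D.mu i).im := by
  have hω := D.omega_pos i
  have h1 : |(D.mu i).im| ≤ D.omega i * D.poleHeight := by
    have := D.abs_im_mu_div_le_poleHeight i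
    rwa [div_le_iff₀ hω, mul_comm] at this
  have h2 : -(D.omega i * D.poleHeight) ≤ (D.mu i).im := by
    linarith [neg_abs_le (D.mu i).im]
  simp only [Complex.add_im, Complex.mul_im, Complex.ofReal_re, Complex.ofReal_im, zero_mul, add_zero]
  nlinarith

/-- Above the pole height, `Im(ωᵢ z + μᵢ) > 0`. [cite: Dobner2021, §4 p. 11] -/
theorem im_omega_mul_add_mu_pos (i : Fin D.numGamma) {z : ℂ} (hz : D.poleHeight < z.im) :
    0 < ((D.omega i : ℂ) * z + D.mu i).im :=
  lt_of_lt_of_le (mul_pos (D.omega_pos i) (by linarith)) (D.omega_mul_im_sub_le i z)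

/-- Above the pole height no `ωᵢ z + μᵢ` is a pole of `Γ`. [cite: Dobner2021, §4 p. 11] -/
theorem omega_mul_add_mu_ne_neg_nat (i : Fin D.numGamma) {z : ℂ} (hz : D.poleHeight < z.im) (m : ℕ) :
    (D.omega i : ℂ) * z + D.mu i ≠ -m := by
  intro h
  have := congrArg Complex.im h
  simp only [Complex.neg_im, Complex.natCast_im, neg_zero] at this
  linarith [D.im_omega_mul_add_mu_pos i hz]

/-- Above the pole height `γ` is holomorphic. [cite: Dobner2021, §4 p. 11] -/
theorem differentiableAt_gamma {z : ℂ} (hz : D.poleHeight < z.im) : DifferentiableAt ℂ D.gamma z := by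
  have e : D.gamma = fun s ↦ D.alpha * s ^ D.polarOrder * (s - 1) ^ D.polarOrder * (D.Q : ℂ) ^ s *
      ∏ i, Complex.Gamma ((D.omega i : ℂ) * s + D.mu i) := by
    funext s; rw [gamma, dobnerGamma_apply]
  rw [e]
  refine DifferentiableAt.mul (DifferentiableAt.mul (DifferentiableAt.mul (DifferentiableAt.mul
    (differentiableAt_const _) (differentiableAt_id.pow _)) ((differentiableAt_id.sub_const _).pow _)) ?_) ?_
  · exact differentiableAt_id.const_cpow (Or.inl (by exact_mod_cast D.Q_pos.ne'))
  · refine DifferentiableAt.fun_finsetProd fun i _ ↦ ?_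
    exact (Complex.differentiableAt_Gamma _ (D.omega_mul_add_mu_ne_neg_nat i hz)).comp z (by fun_prop)

/-- Above the pole height `γ ≠ 0` (no zeros of `Γ`; `z ≠ 0, 1`). [cite: Dobner2021, §4 p. 11] -/
theorem gamma_ne_zero {z : ℂ} (hz : D.poleHeight < z.im) : D.gamma z ≠ 0 := by
  have hz0 : 0 < z.im := lt_of_le_of_lt D.poleHeight_nonneg hz
  have h0 : z ≠ 0 := fun h ↦ by rw [h] at hz0; simp at hz0
  have h1 : z - 1 ≠ 0 := fun h ↦ by
    have := congrArg Complex.im h; simp at this; linarith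
  rw [gamma, dobnerGamma_apply]
  refine mul_ne_zero (mul_ne_zero (mul_ne_zero (mul_ne_zero D.alpha_ne_zero (pow_ne_zero _ h0))
    (pow_ne_zero _ h1)) ?_) ?_
  · rw [Ne, Complex.cpow_eq_zero_iff, not_and_or]
    exact Or.inl (by exact_mod_cast D.Q_pos.ne')
  · exact Finset.prod_ne_zero_iff.2 fun i _ ↦ Complex.Gamma_ne_zero (D.omega_mul_add_mu_ne_neg_nat i hz)

/-! ### Dobner's change of coordinates `J_t`, `γ_t`, the coefficient `A`, the saddle point -/

/-- **Dobner's change of coordinates `J_t`** for the datum, in the EXACT-CANCELLATION variant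
`J_t(s) = s + (|t|/2)(log Q + ∑ᵢ ωᵢ Log(ωᵢ s + μᵢ))`. The source (Thm. 4, p. 8) has
`J_t(s) := s + (|t|/2) log Q + (|t|/2) ∑ᵢ ωᵢ Log(ωᵢ s)`; the two differ by
`δ(s) = (|t|/2) ∑ᵢ ωᵢ (Log(ωᵢ s + μᵢ) − Log(ωᵢ s)) = O(1/|s|)`, which the printed proof absorbs into
the error term of its Lemma 5. With `Log(ωᵢ s + μᵢ)` the linear Taylor terms of `∏ᵢ Γ(ωᵢ z + μᵢ)`
at `z = s` cancel exactly against the Gaussian factor (see the module docstring). [cite: Dobner2021, Thm. 4 (definition of J_t), p. 8] -/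
def dobnerJ (t : ℝ) (s : ℂ) : ℂ :=
  s + ((|t| / 2 : ℝ) : ℂ) *
    ((Real.log D.Q : ℂ) + ∑ i, (D.omega i : ℂ) * Complex.log ((D.omega i : ℂ) * s + D.mu i))

/-- **Dobner's `γ_t(s) = γ(s) exp((s − J_t(s))²/|t|)`** (Thm. 4, p. 8), with this file's `J_t`.
[cite: Dobner2021, Thm. 4 (definition of γ_t), p. 8] -/
def dobnerGammaT (t : ℝ) (s : ℂ) : ℂ :=
  D.gamma s * Complex.exp (((1 / |t| : ℝ) : ℂ) * (s - D.dobnerJ t s) ^ 2)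

/-- **The quadratic coefficient `A`** of the steepest-descent phase, in the exact variant
`A = 1/|t| + ∑ᵢ ωᵢ²/(2(ωᵢ s + μᵢ))` (the second-order Taylor coefficient of `log ∏ Γ(ωᵢ z + μᵢ)` at
`z = s` plus `1/|t|`). The source (p. 10) has `A := 1/|t| + ∑ᵢ ωᵢ/(2s)`; both are
`(1/|t|)(1 + O(|t|/Im s))`, which is all the proof uses (eq. (4.3)). [cite: Dobner2021, §4 p. 10 (definition of A)] -/
def dobnerA (t : ℝ) (s : ℂ) : ℂ :=
  ((1 / |t| : ℝ) : ℂ) + ∑ i, ((D.omega i : ℂ) ^ 2) / (2 * ((D.omega i : ℂ) * s + D.mu i))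

/-- The saddle-point shift `log n/(2A)` (p. 11: the complex Gaussian is centred at `s + log n/(2A)`).
[cite: Dobner2021, §4 p. 11] -/
def dobnerShift (t : ℝ) (n : ℕ) (s : ℂ) : ℂ :=
  (Real.log n : ℂ) / (2 * D.dobnerA t s)

/-- The saddle point `c = s + log n/(2A)` through which the contour is shifted (p. 11).
[cite: Dobner2021, §4 p. 11] -/
def dobnerCenter (t : ℝ) (n : ℕ) (s : ℂ) : ℂ :=
  s + D.dobnerShift t n s

/-! ### The integrand `𝓘`, the integrals `B_{t,n}(s)` and the main term -/

/-- The integrand `𝓘(z) = γ(z) e^{(J_t(s) − z)²/|t|} n^{−z}` of `B_{t,n}(s)` (Lemma 6, p. 11).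
[cite: Dobner2021, Lemma 6 (definition of 𝓘), p. 11] -/
def dobnerI (t : ℝ) (n : ℕ) (s z : ℂ) : ℂ :=
  D.gamma z * (n : ℂ) ^ (-z) * Complex.exp (((1 / |t| : ℝ) : ℂ) * (D.dobnerJ t s - z) ^ 2)

/-- **Dobner's `B_{t,n}(s)`** (eq. (4.1), p. 10):
`B_{t,n}(s) = (1/(i√(π|t|))) ∫_{2−i∞}^{2+i∞} γ(z) e^{(J_t(s) − z)²/|t|} n^{−z} dz
 = (π|t|)^{-1/2} ∫_ℝ 𝓘(2 + iv) dv` (`z = 2 + iv`, `dz = i dv`; the line `Re z = 2` carries no pole of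
`γ`, as `Re(ωᵢ z + μᵢ) > 0` there). [cite: Dobner2021, §4 eq. (4.1), p. 10] -/
def dobnerB (t : ℝ) (n : ℕ) (s : ℂ) : ℂ :=
  ((1 / Real.sqrt (Real.pi * |t|) : ℝ) : ℂ) * ∫ v : ℝ, D.dobnerI t n s (2 + v * I)

/-- The main term `γ_t(s) e^{−(|t|/4) log² n} n^{−s}` of Lemma 4 (i) (p. 10).
[cite: Dobner2021, Lemma 4 (i), p. 10] -/
def dobnerMainTerm (t : ℝ) (n : ℕ) (s : ℂ) : ℂ :=
  D.dobnerGammaT t s * Complex.exp (-(|t| / 4 * Real.log n ^ 2 : ℝ)) * (n : ℂ) ^ (-s)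

/-! ### API -/

/-- `B_{t,0}(s) = 0` (the `n = 0` term is absent in the source; here it vanishes).
[cite: Dobner2021, §4 eq. (4.1), p. 10] -/
theorem dobnerB_zero (t : ℝ) (s : ℂ) : D.dobnerB t 0 s = 0 := by
  simp only [dobnerB, dobnerI, Nat.cast_zero]
  have : ∀ v : ℝ, (0 : ℂ) ^ (-(2 + v * I)) = 0 := fun v ↦
    Complex.zero_cpow (by intro h; have := congrArg Complex.re h; simp at this)
  simp_rw [this, mul_zero, zero_mul, integral_zero, mul_zero]

/-- The main term is `γ_t(s)` times the `n`-th term of `F_t`'s weight series: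
`γ_t(s) e^{−(|t|/4)log² n} n^{−s} = γ_t(s) · term (zetaDeformedCoeff t) s n` (`t < 0`, `s ≠ 0`).
[cite: Dobner2021, Lemma 4 (i), p. 10] -/
theorem dobnerMainTerm_eq {t : ℝ} (ht : t < 0) (n : ℕ) {s : ℂ} (hs : s ≠ 0) :
    D.dobnerMainTerm t n s = D.dobnerGammaT t s * LSeries.term (zetaDeformedCoeff t) s n := by
  rcases Nat.eq_zero_or_pos n with rfl | hn
  · simp [dobnerMainTerm, Complex.zero_cpow (neg_ne_zero.2 hs)]
  have e : Complex.exp (-(|t| / 4 * Real.log n ^ 2 : ℝ)) =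
      ((Real.exp (t / 4 * Real.log n ^ 2) : ℝ) : ℂ) := by
    rw [Complex.ofReal_exp, abs_of_neg ht]
    congr 1
    push_cast
    ring
  rw [dobnerMainTerm, e, LSeries.term_of_ne_zero hn.ne', zetaDeformedCoeff, Complex.cpow_neg,
    div_eq_mul_inv]
  ring

/-- **Modulus of the integrand**: `‖𝓘(z)‖ = ‖γ(z)‖ n^{−Re z} e^{((Re J − Re z)² − (Im J − Im z)²)/|t|}`
(`n ≥ 1`). [cite: Dobner2021, §4 p. 12 (size of the integrand)] -/
theorem norm_dobnerI (t : ℝ) {n : ℕ} (hn : 1 ≤ n) (s z : ℂ) :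
    ‖D.dobnerI t n s z‖ = ‖D.gamma z‖ * (n : ℝ) ^ (-z.re) *
      Real.exp ((((D.dobnerJ t s).re - z.re) ^ 2 - ((D.dobnerJ t s).im - z.im) ^ 2) / |t|) := by
  have hre : (((1 / |t| : ℝ) : ℂ) * (D.dobnerJ t s - z) ^ 2).re =
      (((D.dobnerJ t s).re - z.re) ^ 2 - ((D.dobnerJ t s).im - z.im) ^ 2) / |t| := by
    rw [Complex.re_ofReal_mul, sq, Complex.mul_re]
    simp only [Complex.sub_re, Complex.sub_im]
    ring
  rw [dobnerI, norm_mul, norm_mul, Complex.norm_exp, hre,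
    Complex.norm_natCast_cpow_of_pos (by omega), Complex.neg_re]

/-- The modulus of `γ_t`: `‖γ_t(s)‖ = ‖γ(s)‖ e^{Re((s − J_t(s))²)/|t|}`. [cite: Dobner2021, Thm. 4, p. 8] -/
theorem norm_dobnerGammaT (t : ℝ) (s : ℂ) :
    ‖D.dobnerGammaT t s‖ = ‖D.gamma s‖ * Real.exp (((s - D.dobnerJ t s) ^ 2).re / |t|) := by
  rw [dobnerGammaT, norm_mul, Complex.norm_exp, Complex.re_ofReal_mul]
  congr 2
  ring

/-- The real part of `J_t(s)`: `Re J_t(s) = Re s + (|t|/2)(log Q + ∑ᵢ ωᵢ log|ωᵢ s + μᵢ|)`.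
[cite: Dobner2021, Thm. 4 (definition of J_t), p. 8] -/
theorem dobnerJ_re (t : ℝ) (s : ℂ) : (D.dobnerJ t s).re =
    s.re + |t| / 2 * (Real.log D.Q + ∑ i, D.omega i * Real.log ‖(D.omega i : ℂ) * s + D.mu i‖) := by
  rw [dobnerJ, Complex.add_re, Complex.re_ofReal_mul, Complex.add_re, Complex.ofReal_re, Complex.re_sum]
  congr 2
  refine congrArg _ (Finset.sum_congr rfl fun i _ ↦ ?_)
  rw [Complex.re_ofReal_mul, Complex.log_re]

/-- The imaginary part of `J_t(s)`: `Im J_t(s) = Im s + (|t|/2) ∑ᵢ ωᵢ arg(ωᵢ s + μᵢ)`.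
[cite: Dobner2021, Thm. 4 (definition of J_t), p. 8] -/
theorem dobnerJ_im (t : ℝ) (s : ℂ) : (D.dobnerJ t s).im =
    s.im + |t| / 2 * ∑ i, D.omega i * Complex.arg ((D.omega i : ℂ) * s + D.mu i) := by
  rw [dobnerJ, Complex.add_im, Complex.im_ofReal_mul, Complex.add_im, Complex.ofReal_im, Complex.im_sum,
    zero_add]
  congr 2
  refine Finset.sum_congr rfl fun i _ ↦ ?_
  rw [Complex.im_ofReal_mul, Complex.log_im]

/-- Above the pole height `J_t` is holomorphic (each `ωᵢ s + μᵢ` lies in the upper half-plane,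
inside the slit plane of `Log`). [cite: Dobner2021, §4 p. 11] -/
theorem differentiableAt_dobnerJ (t : ℝ) {s : ℂ} (hs : D.poleHeight < s.im) :
    DifferentiableAt ℂ (D.dobnerJ t) s := by
  unfold dobnerJ
  refine differentiableAt_id.add (DifferentiableAt.const_mul ?_ _)
  refine (differentiableAt_const _).add ?_
  refine DifferentiableAt.fun_sum fun i _ ↦ DifferentiableAt.const_mul ?_ _
  refine DifferentiableAt.clog (by fun_prop) ?_
  exact Complex.mem_slitPlane_iff.2 (Or.inr (D.im_omega_mul_add_mu_pos i hs).ne')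

/-- Above the pole height `γ_t` is holomorphic. [cite: Dobner2021, §4 p. 11] -/
theorem differentiableAt_dobnerGammaT (t : ℝ) {s : ℂ} (hs : D.poleHeight < s.im) :
    DifferentiableAt ℂ (D.dobnerGammaT t) s := by
  unfold dobnerGammaT
  refine (D.differentiableAt_gamma hs).mul ?_
  refine DifferentiableAt.cexp (DifferentiableAt.const_mul ?_ _)
  exact (differentiableAt_id.sub (D.differentiableAt_dobnerJ t hs)).pow _

/-- Above the pole height `γ_t ≠ 0`. [cite: Dobner2021, §4.1 p. 13 (γ_t(s) ≠ 0)] -/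
theorem dobnerGammaT_ne_zero (t : ℝ) {s : ℂ} (hs : D.poleHeight < s.im) : D.dobnerGammaT t s ≠ 0 :=
  mul_ne_zero (D.gamma_ne_zero hs) (Complex.exp_ne_zero _)

/-- **The integrand is holomorphic above the pole height** (in `z`, for fixed `t, n ≥ 1, s`): the
only singularities of `𝓘` are the poles of the `Γ(ωᵢ z + μᵢ)`, all at heights `≤ P`; so every
contour in `{Im z > P}` may be deformed freely (Cauchy). [cite: Dobner2021, §4 p. 11] -/
theorem differentiableAt_dobnerI (t : ℝ) {n : ℕ} (hn : 1 ≤ n) (s : ℂ) {z : ℂ}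
    (hz : D.poleHeight < z.im) : DifferentiableAt ℂ (D.dobnerI t n s) z := by
  unfold dobnerI
  refine DifferentiableAt.mul (DifferentiableAt.mul (D.differentiableAt_gamma hz) ?_) ?_
  · have hn0 : (n : ℂ) ≠ 0 := by exact_mod_cast (show n ≠ 0 by omega)
    exact differentiableAt_id.neg.const_cpow (Or.inl hn0)
  · exact DifferentiableAt.cexp (DifferentiableAt.const_mul
      (((differentiableAt_const _).sub differentiableAt_id).pow _) _)

/-- `𝓘` is holomorphic on the half-plane `{Im z > P}`. [cite: Dobner2021, §4 p. 11] -/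
theorem differentiableOn_dobnerI (t : ℝ) {n : ℕ} (hn : 1 ≤ n) (s : ℂ) :
    DifferentiableOn ℂ (D.dobnerI t n s) {z : ℂ | D.poleHeight < z.im} :=
  fun _ hz ↦ (D.differentiableAt_dobnerI t hn s hz).differentiableWithinAt

/-! ### The size of `A` and of the shift (eq. (4.3): `A = (1/|t|)(1 + O(|t|/y))`) -/

/-- For `Im s ≥ 2P`: `|ωᵢ s + μᵢ| ≥ Im(ωᵢ s + μᵢ) ≥ ωᵢ Im s / 2`. [cite: Dobner2021, §4 eq. (4.3), p. 11] -/
theorem norm_omega_mul_add_mu_ge (i : Fin D.numGamma) {s : ℂ} (hs : 2 * D.poleHeight ≤ s.im) :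
    D.omega i * s.im / 2 ≤ ‖(D.omega i : ℂ) * s + D.mu i‖ := by
  have h1 := D.omega_mul_im_sub_le i s
  have h2 : D.omega i * s.im / 2 ≤ D.omega i * (s.im - D.poleHeight) := by
    have := D.omega_pos i
    nlinarith
  exact (h2.trans h1).trans (Complex.im_le_norm _)

/-- **Eq. (4.3)**: `‖A − 1/|t|‖ ≤ (∑ωᵢ)/Im s` for `Im s ≥ 2P`, `Im s > 0`.
[cite: Dobner2021, §4 eq. (4.3), p. 11] -/
theorem norm_dobnerA_sub_le (t : ℝ) {s : ℂ} (hs0 : 0 < s.im) (hs : 2 * D.poleHeight ≤ s.im) :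
    ‖D.dobnerA t s - ((1 / |t| : ℝ) : ℂ)‖ ≤ D.omegaSum / s.im := by
  rw [dobnerA, add_sub_cancel_left, omegaSum, Finset.sum_div]
  refine (norm_sum_le _ _).trans (Finset.sum_le_sum fun i _ ↦ ?_)
  have hω := D.omega_pos i
  have hw := D.norm_omega_mul_add_mu_ge i hs
  have hw0 : 0 < ‖(D.omega i : ℂ) * s + D.mu i‖ := lt_of_lt_of_le (by positivity) hw
  rw [norm_div, norm_pow, Complex.norm_real, Real.norm_eq_abs, abs_of_pos hω, norm_mul,
    Complex.norm_two, div_le_div_iff₀ (by positivity) hs0]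
  nlinarith

/-- For `Im s ≥ max(2P, 2|t|∑ωᵢ)`: `Re A ≥ 1/(2|t|)`. [cite: Dobner2021, §4 eq. (4.3), p. 11] -/
theorem dobnerA_re_ge {t : ℝ} (ht : t ≠ 0) {s : ℂ} (hs0 : 0 < s.im) (hs : 2 * D.poleHeight ≤ s.im)
    (hst : 2 * |t| * D.omegaSum ≤ s.im) : 1 / (2 * |t|) ≤ (D.dobnerA t s).re := by
  have ht' : 0 < |t| := abs_pos.2 ht
  have h1 := D.norm_dobnerA_sub_le t hs0 hs
  have h2 : |(D.dobnerA t s - ((1 / |t| : ℝ) : ℂ)).re| ≤ D.omegaSum / s.im :=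
    (Complex.abs_re_le_norm _).trans h1
  rw [Complex.sub_re, Complex.ofReal_re] at h2
  have h3 : D.omegaSum / s.im ≤ 1 / (2 * |t|) := by
    rw [div_le_div_iff₀ hs0 (by positivity)]
    nlinarith [D.omegaSum_nonneg]
  have := (abs_le.1 h2).1
  have e : 1 / |t| - 1 / (2 * |t|) = 1 / (2 * |t|) := by field_simp; ring
  linarith

/-- Hence `‖A‖ ≥ 1/(2|t|)` and `A ≠ 0` there. [cite: Dobner2021, §4 eq. (4.3), p. 11] -/
theorem norm_dobnerA_ge {t : ℝ} (ht : t ≠ 0) {s : ℂ} (hs0 : 0 < s.im) (hs : 2 * D.poleHeight ≤ s.im)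
    (hst : 2 * |t| * D.omegaSum ≤ s.im) : 1 / (2 * |t|) ≤ ‖D.dobnerA t s‖ :=
  (D.dobnerA_re_ge ht hs0 hs hst).trans (Complex.re_le_norm _)

/-- `A ≠ 0` in the same range. [cite: Dobner2021, §4 eq. (4.3), p. 11] -/
theorem dobnerA_ne_zero {t : ℝ} (ht : t ≠ 0) {s : ℂ} (hs0 : 0 < s.im) (hs : 2 * D.poleHeight ≤ s.im)
    (hst : 2 * |t| * D.omegaSum ≤ s.im) : D.dobnerA t s ≠ 0 := by
  have h := D.norm_dobnerA_ge ht hs0 hs hst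
  have ht' : 0 < |t| := abs_pos.2 ht
  intro h0
  rw [h0, norm_zero] at h
  have : 0 < 1 / (2 * |t|) := by positivity
  linarith

/-- The shift is at most `|t| log n` in modulus (`n ≥ 1`). [cite: Dobner2021, §4 p. 11 ("(1/2A) log n ≪ y^{3/5}")] -/
theorem norm_dobnerShift_le {t : ℝ} (ht : t ≠ 0) {s : ℂ} (hs0 : 0 < s.im) (hs : 2 * D.poleHeight ≤ s.im)
    (hst : 2 * |t| * D.omegaSum ≤ s.im) {n : ℕ} (hn : 1 ≤ n) :
    ‖D.dobnerShift t n s‖ ≤ |t| * Real.log n := by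
  have ht' : 0 < |t| := abs_pos.2 ht
  have hA := D.norm_dobnerA_ge ht hs0 hs hst
  have hA0 : 0 < ‖D.dobnerA t s‖ := lt_of_lt_of_le (by positivity) hA
  have hlog : 0 ≤ Real.log n := Real.log_nonneg (by exact_mod_cast hn)
  rw [dobnerShift, norm_div, Complex.norm_real, Real.norm_eq_abs, abs_of_nonneg hlog, norm_mul,
    Complex.norm_two, div_le_iff₀ (by positivity)]
  have : Real.log n * 1 ≤ Real.log n * (2 * |t| * ‖D.dobnerA t s‖) := by
    refine mul_le_mul_of_nonneg_left ?_ hlog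
    have := mul_le_mul_of_nonneg_left hA (show 0 ≤ 2 * |t| by positivity)
    rw [mul_one_div_cancel (by positivity)] at this
    exact this
  nlinarith

end ExtendedSelbergDatum

end Literature.NumberTheory.LFunctions

end
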